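import Mathlib
import Summits.Ventures.DiscreteObjects.Mahler.SmallMeasureCensus
import Summits.Ventures.DiscreteObjects.Mahler.ReciprocalCoeffBound

/-!
# Soundness of the census power-sum test (T1) for reciprocal root configurations

Cell `pub-namedobj`, seat `pub-namedobj-mahler-g2`, target (L). Framing: lottery ticket; floor = certified
bounds/negative ranges.

The census engines prune with `T1: |s_k(P)| < n - 2 + B^k + B^{-k}` (`k ≥ 1`), where `s_k` is the `k`-th power sum
of the roots of the reciprocal polynomial `P` of degree `n = 2d` and `M(P) < B`. For a reciprocal root
configuration — a multiset `s` of `d` nonzero "half-roots" `α`, the roots of `P = ∏_{α∈s} (x-α)(x-1/α)` being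
`α, 1/α` — we prove:

* `halfRoots_prod_eq`: `(x-α)(x-α⁻¹) = x² - (α+α⁻¹)x + 1` (so this is the class of `ReciprocalCoeffBound`);
* `mahlerMeasure_halfRoots`: `M(P) = exp (Σ_{α∈s} |log ‖α‖|)`;
* `powerSum_bound`: `‖Σ_{α∈s} (α^k + α^{-k})‖ ≤ 2(d-1) + M^k + M^{-k}`;
* `powerSum_bound_strict`: if `M(P) < B` and `k ≥ 1` then `‖Σ (α^k + α^{-k})‖ < (2d - 2) + B^k + B^{-k}` — T1;
* `roots_powerSum_eq`: `Σ_{z ∈ P.roots} z^k = Σ_{α∈s} (α^k + α^{-k})`, identifying the bounded quantity with the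
  power sum of the roots that the engines compute by Newton's identities.
-/

namespace Summit.Ventures.DiscreteObjects.Mahler

open Polynomial

/-- `(x-α)(x-α⁻¹) = x² - (α+α⁻¹)x + 1` for `α ≠ 0`. -/
theorem halfRoots_prod_eq {α : ℂ} (hα : α ≠ 0) :
    (X - C α) * (X - C α⁻¹) = (X ^ 2 - C (α + α⁻¹) * X + 1 : ℂ[X]) := by
  have : (X - C α) * (X - C α⁻¹) = X ^ 2 - C (α + α⁻¹) * X + C (α * α⁻¹) := by
    rw [map_add, map_mul]; ring
  rw [this, mul_inv_cancel₀ hα, map_one]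

/-- `M((x-α)(x-α⁻¹)) = exp |log ‖α‖|`. -/
theorem mahlerMeasure_halfRoot {α : ℂ} (hα : α ≠ 0) :
    ((X - C α) * (X - C α⁻¹) : ℂ[X]).mahlerMeasure = Real.exp |Real.log ‖α‖| := by
  have hr0 : 0 < ‖α‖ := norm_pos_iff.mpr hα
  rw [mahlerMeasure_mul, mahlerMeasure_X_sub_C, mahlerMeasure_X_sub_C, norm_inv]
  rcases le_or_gt 1 ‖α‖ with h1 | h1
  · rw [abs_of_nonneg (Real.log_nonneg h1), Real.exp_log hr0, max_eq_right h1,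
      max_eq_left (inv_le_one_of_one_le₀ h1), mul_one]
  · rw [abs_of_neg (Real.log_neg hr0 h1), Real.exp_neg, Real.exp_log hr0, max_eq_left h1.le,
      max_eq_right (one_le_inv_iff₀.mpr ⟨hr0, h1.le⟩), one_mul]

/-- `M(∏_{α∈s} (x-α)(x-α⁻¹)) = exp (Σ_{α∈s} |log ‖α‖|)`. -/
theorem mahlerMeasure_halfRoots (s : Multiset ℂ) (hs : ∀ α ∈ s, α ≠ 0) :
    (s.map fun α => ((X - C α) * (X - C α⁻¹) : ℂ[X])).prod.mahlerMeasure =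
      Real.exp (s.map fun α => |Real.log ‖α‖|).sum := by
  rw [prod_mahlerMeasure_eq_mahlerMeasure_prod, Multiset.map_map, exp_multiset_sum, Multiset.map_map]
  congr 1
  exact Multiset.map_congr rfl fun α hα => mahlerMeasure_halfRoot (hs α hα)

/-- `‖α^k + α^{-k}‖ ≤ 2 cosh (k |log ‖α‖|)`. -/
theorem norm_pow_add_inv_pow_le {α : ℂ} (hα : α ≠ 0) (k : ℕ) :
    ‖α ^ k + α⁻¹ ^ k‖ ≤ 2 * Real.cosh (k * |Real.log ‖α‖|) := by
  have hr0 : 0 < ‖α‖ := norm_pos_iff.mpr hα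
  have key : 2 * Real.cosh (k * |Real.log ‖α‖|) = ‖α‖ ^ k + (‖α‖ ^ k)⁻¹ := by
    rw [← abs_of_nonneg (Nat.cast_nonneg k : (0:ℝ) ≤ k), ← abs_mul, Real.cosh_abs, Real.cosh_eq,
      ← Real.log_pow, Real.exp_neg, Real.exp_log (pow_pos hr0 k)]
    ring
  rw [key]
  calc ‖α ^ k + α⁻¹ ^ k‖ ≤ ‖α ^ k‖ + ‖α⁻¹ ^ k‖ := norm_add_le _ _
    _ = ‖α‖ ^ k + (‖α‖ ^ k)⁻¹ := by rw [norm_pow, norm_pow, norm_inv, inv_pow]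

/-- Majorisation for sums of `cosh`: `Σ cosh(vᵢ) ≤ cosh(Σ vᵢ) + (card - 1)` for `vᵢ ≥ 0`, nonempty. -/
theorem sum_cosh_le (w : Multiset ℝ) (hw : ∀ v ∈ w, 0 ≤ v) (hne : w ≠ 0) :
    (w.map Real.cosh).sum ≤ Real.cosh w.sum + (Multiset.card w - 1 : ℝ) := by
  induction w using Multiset.induction_on with
  | empty => exact absurd rfl hne
  | cons a s ih =>
    have ha : 0 ≤ a := hw a (Multiset.mem_cons_self a s)
    have hs : ∀ v ∈ s, 0 ≤ v := fun v hv => hw v (Multiset.mem_cons_of_mem hv)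
    rw [Multiset.map_cons, Multiset.sum_cons, Multiset.sum_cons, Multiset.card_cons]
    by_cases hs0 : s = 0
    · subst hs0; simp
    · have ih' := ih hs hs0
      have hsum : 0 ≤ s.sum := Multiset.sum_nonneg hs
      have h2 := cosh_add_cosh_le ha hsum
      push_cast
      linarith

/-- **T1 soundness (exact form).** For nonzero half-roots `s` (`d = |s| ≥ 1`) and
`P = ∏_{α∈s}(x-α)(x-α⁻¹)` with `M = M(P)`: `‖Σ_{α∈s} (α^k + α^{-k})‖ ≤ 2(d-1) + M^k + M^{-k}`. -/
theorem powerSum_bound (s : Multiset ℂ) (hs : ∀ α ∈ s, α ≠ 0) (hne : s ≠ 0) (k : ℕ) :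
    ‖(s.map fun α => α ^ k + α⁻¹ ^ k).sum‖ ≤
      2 * (Multiset.card s - 1 : ℝ) +
        (s.map fun α => ((X - C α) * (X - C α⁻¹) : ℂ[X])).prod.mahlerMeasure ^ k +
        ((s.map fun α => ((X - C α) * (X - C α⁻¹) : ℂ[X])).prod.mahlerMeasure ^ k)⁻¹ := by
  rw [mahlerMeasure_halfRoots s hs]
  set w : Multiset ℝ := s.map fun α => (k : ℝ) * |Real.log ‖α‖| with hw
  have hwnn : ∀ v ∈ w, 0 ≤ v := by
    intro v hv; rw [hw] at hv
    obtain ⟨α, _, rfl⟩ := Multiset.mem_map.mp hv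
    positivity
  have hwne : w ≠ 0 := by rw [hw]; simpa using hne
  have hcard : Multiset.card w = Multiset.card s := by rw [hw, Multiset.card_map]
  -- termwise bound then majorisation
  have h1 : ‖(s.map fun α => α ^ k + α⁻¹ ^ k).sum‖ ≤ (w.map fun v => 2 * Real.cosh v).sum := by
    refine le_trans (Multiset.le_sum_of_subadditive (fun z : ℂ => ‖z‖) norm_zero.le norm_add_le _) ?_
    rw [Multiset.map_map, hw, Multiset.map_map]
    apply Multiset.sum_map_le_sum_map
    intro α hα
    exact norm_pow_add_inv_pow_le (hs α hα) k
  have h2 : (w.map fun v => 2 * Real.cosh v).sum = 2 * (w.map Real.cosh).sum := by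
    rw [Multiset.sum_map_mul_left]
  have h3 := sum_cosh_le w hwnn hwne
  have h4 : Real.cosh w.sum = (Real.exp (s.map fun α => |Real.log ‖α‖|).sum ^ k +
      (Real.exp (s.map fun α => |Real.log ‖α‖|).sum ^ k)⁻¹) / 2 := by
    rw [Real.cosh_eq, ← Real.exp_nat_mul, ← Real.exp_neg]
    congr 2
    · rw [hw, Multiset.sum_map_mul_left]
    · rw [hw, Multiset.sum_map_mul_left]
  rw [hcard] at h3
  calc ‖(s.map fun α => α ^ k + α⁻¹ ^ k).sum‖ ≤ (w.map fun v => 2 * Real.cosh v).sum := h1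
    _ = 2 * (w.map Real.cosh).sum := h2
    _ ≤ 2 * (Real.cosh w.sum + (Multiset.card s - 1 : ℝ)) := by linarith
    _ = _ := by rw [h4]; ring

/-- `x ↦ x^k + x^{-k}` is strictly increasing on `[1, ∞)` for `k ≥ 1`. -/
theorem pow_add_inv_pow_lt {x y : ℝ} (hx : 1 ≤ x) (hxy : x < y) {k : ℕ} (hk : 0 < k) :
    x ^ k + (x ^ k)⁻¹ < y ^ k + (y ^ k)⁻¹ := by
  have hx0 : 0 < x := by linarith
  have hxk : 1 ≤ x ^ k := one_le_pow₀ hx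
  have hlt : x ^ k < y ^ k := pow_lt_pow_left₀ hxy hx0.le hk.ne'
  have hyk : 0 < y ^ k := by linarith
  have key : (y ^ k + (y ^ k)⁻¹) - (x ^ k + (x ^ k)⁻¹) =
      (y ^ k - x ^ k) * (y ^ k * x ^ k - 1) / (y ^ k * x ^ k) := by
    field_simp; ring
  have hnum : 0 < (y ^ k - x ^ k) * (y ^ k * x ^ k - 1) := by
    apply mul_pos (by linarith); nlinarith
  have : 0 < (y ^ k + (y ^ k)⁻¹) - (x ^ k + (x ^ k)⁻¹) := by rw [key]; positivity
  linarith

/-- **T1 as used by the engines (strict form).** If `M(P) < B` for `P = ∏_{α∈s}(x-α)(x-α⁻¹)` (`d = |s| ≥ 1`)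
then for every `k ≥ 1`: `‖Σ_{α∈s}(α^k + α^{-k})‖ < (2d - 2) + B^k + B^{-k}`. -/
theorem powerSum_bound_strict (s : Multiset ℂ) (hs : ∀ α ∈ s, α ≠ 0) (hne : s ≠ 0) {k : ℕ} (hk : 0 < k)
    {B : ℝ} (hB : (s.map fun α => ((X - C α) * (X - C α⁻¹) : ℂ[X])).prod.mahlerMeasure < B) :
    ‖(s.map fun α => α ^ k + α⁻¹ ^ k).sum‖ < 2 * (Multiset.card s - 1 : ℝ) + B ^ k + (B ^ k)⁻¹ := by
  set P := (s.map fun α => ((X - C α) * (X - C α⁻¹) : ℂ[X])).prod with hP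
  have h1 := powerSum_bound s hs hne k
  rw [← hP] at h1
  have hmonic : P.Monic := by
    rw [hP]; apply monic_multiset_prod_of_monic; intro α _
    exact (monic_X_sub_C _).mul (monic_X_sub_C _)
  have hM1 : 1 ≤ P.mahlerMeasure := by
    apply one_le_mahlerMeasure_of_one_le_norm_leadingCoeff
    rw [hmonic.leadingCoeff, norm_one]
  have h2 := pow_add_inv_pow_lt hM1 hB hk
  linarith

/-- The bounded quantity IS the power sum of the roots: `Σ_{z ∈ roots P} z^k = Σ_{α∈s} (α^k + α^{-k})`. -/
theorem roots_powerSum_eq (s : Multiset ℂ) (k : ℕ) :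
    (((s.map fun α => ((X - C α) * (X - C α⁻¹) : ℂ[X])).prod.roots).map fun z => z ^ k).sum =
      (s.map fun α => α ^ k + α⁻¹ ^ k).sum := by
  induction s using Multiset.induction_on with
  | empty => simp
  | cons a s ih =>
    rw [Multiset.map_cons, Multiset.prod_cons, Multiset.map_cons, Multiset.sum_cons]
    have hne : ((X - C a) * (X - C a⁻¹)) * (s.map fun α => ((X - C α) * (X - C α⁻¹) : ℂ[X])).prod ≠ 0 := by
      apply mul_ne_zero (mul_ne_zero (X_sub_C_ne_zero a) (X_sub_C_ne_zero a⁻¹))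
      intro h0
      rw [Multiset.prod_eq_zero_iff] at h0
      obtain ⟨α, _, hα⟩ := Multiset.mem_map.mp h0
      exact mul_ne_zero (X_sub_C_ne_zero α) (X_sub_C_ne_zero α⁻¹) hα
    rw [roots_mul hne, roots_mul (mul_ne_zero (X_sub_C_ne_zero a) (X_sub_C_ne_zero a⁻¹)),
      roots_X_sub_C, roots_X_sub_C, Multiset.map_add, Multiset.sum_add, ih]
    simp

end Summit.Ventures.DiscreteObjects.Mahler
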